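import Literature.AlgebraicGeometry.Motives.GrassmannianSheaf
import Literature.AlgebraicGeometry.Motives.GrassmannianMapLocalization
import Mathlib.AlgebraicGeometry.ValuativeCriterion
import Mathlib.RingTheory.Flat.TorsionFree
import Mathlib.RingTheory.LocalRing.Module
import Mathlib.RingTheory.Valuation.ValuationRing
import Mathlib.RingTheory.LocalProperties.Projective
import Mathlib.Algebra.Module.LocalizedModule.Submodule
import HarnessLib

/-!
# The Grassmannian satisfies the valuative criteria (hence: separated, proper over `ℤ`)

Topic `AlgebraicGeometry/Motives`; namespace `Literature.AlgebraicGeometry.Motives.Grassmannian`.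
THEOREMS ONLY (no definition, no instance, no notation, no named fact, no `sorry`).

[GortzWedhorn2020, Example 15.12 (Section (15.2) «Valuative criteria», pp. 494–497)] proves that `Grass_{d,n} → Spec ℤ` is
proper by the valuative criterion (Thm. 15.9): for a valuation ring `A` with fraction field `K` the map
`Grass(A) → Grass(K)`, `U ↦ U ⊗_A K`, is bijective with inverse `W ↦ W ∩ Aⁿ`.  We prove exactly this for Mathlib's
Grassmannian functor `A ↦ G(k, A ⊗_R M; A) = Module.Grassmannian A (A ⊗[R] M) k` (quotients locally free of rank `k`,
[StacksProject, Tag 089R]) and transport it to the Grassmannian SCHEME of ★ `GrassmannianSheaf` (§4 there: `grassmannianScheme M k`,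
`specPointsEquiv`, available under `[(grassmannianSheaf M k).obj.IsRepresentable]`, the representability theorem (h4) (A4)):

* §1 (pure algebra) **`restrictScalars_comap_rTensor_map`** — for an INJECTIVE algebra map `φ : A → B` and `N ∈ G(k, A ⊗ M; A)`,
  `(φ ⊗ 1)⁻¹ (map φ N) = N` (the quotient is projective, hence flat, so `Q ↪ B ⊗_A Q`); hence
  **`map_injective_of_injective`**: `Module.Grassmannian.map φ` is injective — the Grassmannian functor is «separated» along
  every injective ring map, no valuation hypothesis;
* §2 (pure algebra) **`exists_map_eq_of_valuationRing`** / **`map_surjective_of_valuationRing`** — for a valuation ring `A`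
  with fraction field `K` and `M` finite over `R`, `map (A → K) : G(k, A ⊗ M; A) → G(k, K ⊗ M; K)` is surjective: the
  saturation `N₀ := (φ ⊗ 1)⁻¹ N_K` has torsion-free finite quotient, which over a valuation ring (Bézout + local) is flat
  (Mathlib `Module.Flat.flat_iff_torsion_eq_bot_of_isBezout`) hence free (`Module.free_of_flat_of_isLocalRing`), of rank `k`
  because its localisation at `A⁰` is `(K ⊗ M)/N_K` (Mathlib `Submodule.localized'gi`, `IsLocalizedModule.toLocalizedQuotient'`,
  `Module.finrank_of_isLocalizedModule_of_free`; ★ `map_toSubmodule_eq_localized'`);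
* §3 (schemes, under `[IsRepresentable]`) **`valuativeCriterion_uniqueness`** (any `M`), **`valuativeCriterion_existence`**
  (`M` finite over `ℤ`), **`valuativeCriterion`**, and the Mathlib corollaries
  **`isSeparated_of_quasiSeparated`** (`IsSeparated.of_valuativeCriterion`, [StacksProject, Tag 01L0]),
  **`universallyClosed_of_quasiCompact`** ([StacksProject, Tag 01KF]) and
  **`isProper_of_quasiCompact`** (`IsProper.of_valuativeCriterion`, [StacksProject, Tag 0BX5]) — the topological / finite-type
  side conditions are discharged from the finite affine chart cover `𝔸^{k(n−k)}_ℤ` in a sequel ([GortzWedhorn2020, Cor. 8.15 (p. 216)]).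

Cell `hodgecm-mathlib` (D-0151), F-DAG hand (h4) «Grassmannian as a scheme» (B-p21 lineage), brick (A6); count-neutral
Mathlib-side capital.  Nothing here is about HC; HC_CM is proved only modulo the 7 printed citations until rung 0 closes.

## References
* [GortzWedhorn2020] U. Görtz, T. Wedhorn, *Algebraic Geometry I*, 2nd ed. (2020), Example 15.12 with Thm. 15.9 (Section (15.2),
  pp. 494–497); (8.4) (pp. 213–215), Cor. 8.15 (p. 216); (9.4) p. 235 (Grassmannians are separated).
* [StacksProject] The Stacks project, Tags 089R (Grassmannians), 01KF, 01L0/01KZ, 0BX5 (valuative criteria).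
-/

namespace Literature.AlgebraicGeometry.Motives.Grassmannian

open TensorProduct

/-! ## §1 Injectivity of `map φ` along an injective algebra map -/

section Algebra

universe u' v' w'

-- `Module.Grassmannian.map` asks the two algebras to live in one universe (Mathlib), hence `A B K : Type w'` below.
variable {R : Type u'} [CommRing R] {M : Type v'} [AddCommGroup M] [Module R M] {k : ℕ}
  {A B : Type w'} [CommRing A] [Algebra R A] [CommRing B] [Algebra R B]

/-- **`(φ ⊗ 1)⁻¹ (map φ N) = N` for an injective algebra map `φ : A → B`.**  Mathlib defines `map φ N` as the kernel of
`B ⊗_R M ≃ B ⊗_A (A ⊗_R M) → B ⊗_A Q`, `Q := (A ⊗_R M)/N`; on `(φ ⊗ 1) x` this map takes the value `1 ⊗ q(x)`, and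
`q ↦ 1 ⊗ q : Q → B ⊗_A Q` is injective because `Q` is projective (hence flat) and `φ` is injective.  This is the
injectivity half of [GortzWedhorn2020, Example 15.12] («`U ↦ U ⊗_A K` … with inverse `W ↦ W ∩ Aⁿ`»), valid for every
injective `φ`. [cite: GortzWedhorn2020, Example 15.12 (Section (15.2), pp. 494–497)] [cite: StacksProject, Tag 089R] -/
theorem restrictScalars_comap_rTensor_map (φ : A →ₐ[R] B) (hφ : Function.Injective φ)
    (N : Module.Grassmannian A (A ⊗[R] M) k) :
    ((Module.Grassmannian.map φ N).toSubmodule.restrictScalars R).comap (φ.toLinearMap.rTensor M) =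
      N.toSubmodule.restrictScalars R := by
  letI : Algebra A B := φ.toRingHom.toAlgebra
  letI : IsScalarTower R A B := IsScalarTower.of_algebraMap_eq' <| IsScalarTower.algebraMap_eq R A B
  ext x
  rw [Submodule.mem_comap, Submodule.restrictScalars_mem, Submodule.restrictScalars_mem,
    Module.Grassmannian.map_toSubmodule, LinearMap.mem_ker]
  -- the value of Mathlib's `baseChangeMkQ` on `(φ ⊗ 1) x` is `1 ⊗ q(x)`
  have hF : Module.Grassmannian.baseChangeMkQ B N.toSubmodule (φ.toLinearMap.rTensor M x) =
      (1 : B) ⊗ₜ[A] N.toSubmodule.mkQ x := by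
    change N.toSubmodule.mkQ.baseChange B ((AlgebraTensorModule.cancelBaseChange R A B B M).symm
      (φ.toLinearMap.rTensor M x)) = _
    have hx : φ.toLinearMap.rTensor M x =
        AlgebraTensorModule.cancelBaseChange R A B B M ((1 : B) ⊗ₜ[A] x) := by
      rw [cancelBaseChange_one_tmul]
      induction x using TensorProduct.induction_on with
      | zero => simp
      | tmul a m => rfl
      | add x y hx hy => rw [map_add, map_add, hx, hy]
    rw [hx, LinearEquiv.symm_apply_apply, LinearMap.baseChange_tmul]
  rw [hF, Submodule.mkQ_apply]
  constructor
  · intro h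
    -- `Q := (A ⊗ M)/N` is projective, hence flat: `q ↦ 1 ⊗ q : Q → B ⊗[A] Q` is injective since `φ` is
    have hinj : Function.Injective
        ((Algebra.linearMap A B).rTensor ((A ⊗[R] M) ⧸ N.toSubmodule)) :=
      Module.Flat.rTensor_preserves_injective_linearMap _ (fun a b hab => hφ hab)
    have h1 : (Algebra.linearMap A B).rTensor ((A ⊗[R] M) ⧸ N.toSubmodule)
        ((1 : A) ⊗ₜ[A] Submodule.Quotient.mk x) = 0 := by
      rw [LinearMap.rTensor_tmul, Algebra.linearMap_apply, map_one, h]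
    have h2 : (1 : A) ⊗ₜ[A] (Submodule.Quotient.mk x : (A ⊗[R] M) ⧸ N.toSubmodule) = 0 :=
      hinj (by rw [h1, map_zero])
    have h3 := congrArg (TensorProduct.lid A ((A ⊗[R] M) ⧸ N.toSubmodule)) h2
    rw [TensorProduct.lid_tmul, one_smul, map_zero] at h3
    exact (Submodule.Quotient.mk_eq_zero _).mp h3
  · intro h
    rw [(Submodule.Quotient.mk_eq_zero _).mpr h, tmul_zero]

/-- **`Module.Grassmannian.map φ` is injective for an injective algebra map `φ : A → B`** (the Grassmannian functor is
separated along injective ring maps; for `B = Frac A` this is the uniqueness half of the valuative criterion,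
[GortzWedhorn2020, Example 15.12]). [cite: GortzWedhorn2020, Example 15.12 (Section (15.2), pp. 494–497)] [cite: StacksProject, Tag 089R] -/
theorem map_injective_of_injective (φ : A →ₐ[R] B) (hφ : Function.Injective φ) :
    Function.Injective (Module.Grassmannian.map (M := M) (k := k) φ) := by
  intro N₁ N₂ h
  ext : 1
  apply Submodule.restrictScalars_injective R
  rw [← restrictScalars_comap_rTensor_map φ hφ N₁, ← restrictScalars_comap_rTensor_map φ hφ N₂, h]

/-! ## §2 Surjectivity of `map (A → Frac A)` for a valuation ring `A` -/

/-- **Saturation over a valuation ring** ([GortzWedhorn2020, Example 15.12], «inverse map `W ↦ W ∩ Aⁿ`»): for a valuation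
ring `A` with fraction field `K`, `M` finite over `R` and `N_K ∈ G(k, K ⊗_R M; K)`, the preimage `N₀ := (φ ⊗ 1)⁻¹ N_K ⊆ A ⊗_R M`
lies in `G(k, A ⊗_R M; A)` and `map (A → K) N₀ = N_K`.  Proof: `Q := (A ⊗ M)/N₀` embeds (up to `A⁰`-localisation) into the
`K`-vector space `(K ⊗ M)/N_K`, so it is torsion-free, hence flat (`A` is Bézout), hence free (`A` is local), and its rank is
`dim_K (K ⊗ M)/N_K = k` because `(K ⊗ M)/N_K` is its localisation (`N₀.localized' = N_K`, Mathlib's Galois insertion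
`Submodule.localized'gi`); finally ★ `map_toSubmodule_eq_localized'` identifies `map (A → K) N₀` with `N₀.localized' = N_K`.
[cite: GortzWedhorn2020, Example 15.12 (Section (15.2), pp. 494–497)] [cite: StacksProject, Tag 089R] -/
theorem exists_map_eq_of_valuationRing [IsDomain A] [ValuationRing A] {K : Type w'} [Field K] [Algebra R K]
    [Algebra A K] [IsScalarTower R A K] [IsFractionRing A K] [Module.Finite R M]
    (NK : Module.Grassmannian K (K ⊗[R] M) k) :
    ∃ N : Module.Grassmannian A (A ⊗[R] M) k,
      Module.Grassmannian.map (IsScalarTower.toAlgHom R A K) N = NK := by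
  -- the localisation `ι = (A → K) ⊗ 1 : A ⊗ M → K ⊗ M` at `S := A⁰`
  let S : Submonoid A := nonZeroDivisors A
  let ι : A ⊗[R] M →ₗ[A] K ⊗[R] M := AlgebraTensorModule.rTensor R M (Algebra.linearMap A K)
  -- the saturation and its localisation
  let N₀ : Submodule A (A ⊗[R] M) := (NK.toSubmodule.restrictScalars A).comap ι
  have hloc : N₀.localized' K S ι = NK.toSubmodule := (Submodule.localized'gi K S ι).l_u_eq NK.toSubmodule
  -- the quotient `Q` and its localisation map `Q → (K ⊗ M)/N₀.localized'`
  have htors : Submodule.torsion A ((A ⊗[R] M) ⧸ N₀) = ⊥ := by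
    rw [eq_bot_iff]
    intro q hq
    obtain ⟨⟨s, hs⟩, hsq⟩ := (Submodule.mem_torsion_iff q).mp hq
    obtain ⟨x, rfl⟩ := Submodule.Quotient.mk_surjective N₀ q
    rw [Submodule.mem_bot, Submodule.Quotient.mk_eq_zero]
    rw [Submonoid.mk_smul, ← Submodule.Quotient.mk_smul, Submodule.Quotient.mk_eq_zero] at hsq
    -- `hsq : s • x ∈ N₀`, i.e. `(algebraMap A K s) • ι x ∈ N_K`; divide by the unit `algebraMap A K s`
    have hsx : ι (s • x) ∈ NK.toSubmodule := hsq
    rw [map_smul, ← algebraMap_smul K s (ι x)] at hsx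
    have hne : algebraMap A K s ≠ 0 := IsFractionRing.to_map_ne_zero_of_mem_nonZeroDivisors hs
    change ι x ∈ NK.toSubmodule
    exact (Submodule.smul_mem_iff NK.toSubmodule hne).mp hsx
  haveI hflat : Module.Flat A ((A ⊗[R] M) ⧸ N₀) :=
    Module.Flat.flat_iff_torsion_eq_bot_of_isBezout.mpr htors
  haveI hfree : Module.Free A ((A ⊗[R] M) ⧸ N₀) := Module.free_of_flat_of_isLocalRing
  -- the rank: `dim_A Q = dim_K (K ⊗ M)/N₀.localized' = dim_K (K ⊗ M)/N_K = k`
  have hfin : Module.finrank A ((A ⊗[R] M) ⧸ N₀) = k := by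
    have h1 := Module.finrank_of_isLocalizedModule_of_free K S (N₀.toLocalizedQuotient' K S ι)
    rw [← h1, (Submodule.quotEquivOfEq _ _ hloc).finrank_eq]
    have h2 := NK.rankAtStalk_eq ⟨⊥, Ideal.isPrime_bot⟩
    rw [Module.rankAtStalk_eq_finrank_of_free] at h2
    exact h2
  have hrank : ∀ p, Module.rankAtStalk (R := A) ((A ⊗[R] M) ⧸ N₀) p = k := by
    intro p
    rw [Module.rankAtStalk_eq_finrank_of_free]
    exact hfin
  refine ⟨⟨N₀, inferInstance, inferInstance, hrank⟩, ?_⟩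
  ext : 1
  rw [map_toSubmodule_eq_localized' S]
  exact hloc

/-- **Surjectivity of `map (A → Frac A)` for a valuation ring `A`** (`M` finite over `R`), for any `R`-algebra map `φ`
that agrees with the structure map `A → K` — the existence half of the valuative criterion for the Grassmannian
functor [GortzWedhorn2020, Example 15.12]. [cite: GortzWedhorn2020, Example 15.12 (Section (15.2), pp. 494–497)] [cite: StacksProject, Tag 089R] -/
theorem map_surjective_of_valuationRing [IsDomain A] [ValuationRing A] {K : Type w'} [Field K] [Algebra R K]
    [Algebra A K] [IsFractionRing A K] [Module.Finite R M] (φ : A →ₐ[R] K)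
    (hφ : ∀ a, φ a = algebraMap A K a) :
    Function.Surjective (Module.Grassmannian.map (M := M) (k := k) φ) := by
  haveI : IsScalarTower R A K := IsScalarTower.of_algebraMap_eq' <| RingHom.ext fun r => by
    rw [RingHom.comp_apply, ← hφ, AlgHom.commutes]
  have hφ' : φ = IsScalarTower.toAlgHom R A K := AlgHom.ext hφ
  rw [hφ']
  intro NK
  exact exists_map_eq_of_valuationRing NK

end Algebra

/-! ## §3 The valuative criteria for the Grassmannian scheme -/

section Scheme

open CategoryTheory CategoryTheory.Limits Opposite _root_.AlgebraicGeometry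

universe u

variable (M : Type u) [AddCommGroup M] (k : ℕ) [(grassmannianSheaf M k).obj.IsRepresentable]

/-- **Uniqueness part of the valuative criterion for `grassmannianScheme M k → Spec ℤ`** (any abelian group `M`): two
`A`-points (`A` a valuation ring) with the same restriction to `Frac A` coincide — through ★ `specPointsEquiv` /
`specPointsEquiv_naturality` this is `map_injective_of_injective` for `A → Frac A`.
[cite: GortzWedhorn2020, Example 15.12 (Section (15.2), pp. 494–497)] [cite: StacksProject, Tag 01KZ] -/
theorem valuativeCriterion_uniqueness :
    ValuativeCriterion.Uniqueness (terminal.from (grassmannianScheme M k)) := by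
  intro S
  refine ⟨fun l₁ l₂ => ?_⟩
  ext
  have hinj : Function.Injective (CommRingCat.ofHom (algebraMap S.R S.K)).hom.toIntAlgHom :=
    fun a b hab => IsFractionRing.injective S.R S.K hab
  apply (specPointsEquiv M k (CommRingCat.of S.R)).injective
  apply map_injective_of_injective (R := ℤ) (M := M) (k := k) _ hinj
  rw [← specPointsEquiv_naturality, ← specPointsEquiv_naturality, l₁.fac_left, l₂.fac_left]

/-- **Existence part of the valuative criterion for `grassmannianScheme M k → Spec ℤ`** (`M` a finitely generated abelian
group): every `Frac A`-point extends to an `A`-point (`A` a valuation ring) — through ★ `specPointsEquiv` this is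
`map_surjective_of_valuationRing`. [cite: GortzWedhorn2020, Example 15.12 (Section (15.2), pp. 494–497)] [cite: StacksProject, Tag 01KF] -/
theorem valuativeCriterion_existence [Module.Finite ℤ M] :
    ValuativeCriterion.Existence (terminal.from (grassmannianScheme M k)) := by
  intro S
  have hφ : ∀ a, (CommRingCat.ofHom (algebraMap S.R S.K)).hom.toIntAlgHom a = algebraMap S.R S.K a :=
    fun a => rfl
  obtain ⟨N, hN⟩ := map_surjective_of_valuationRing (R := ℤ) (M := M) (k := k) _ hφ
    (specPointsEquiv M k (CommRingCat.of S.K) S.i₁)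
  exact CommSq.HasLift.mk'
    { l := (specPointsEquiv M k (CommRingCat.of S.R)).symm N
      fac_left := by
        apply (specPointsEquiv M k (CommRingCat.of S.K)).injective
        rw [specPointsEquiv_naturality, Equiv.apply_symm_apply, hN]
      fac_right := terminal.hom_ext _ _ }

/-- **The Grassmannian scheme satisfies the valuative criterion** (existence and uniqueness) over `Spec ℤ`, for `M` a
finitely generated abelian group. [cite: GortzWedhorn2020, Example 15.12 (Section (15.2), pp. 494–497)] [cite: StacksProject, Tag 0BX5] -/
theorem valuativeCriterion [Module.Finite ℤ M] :
    ValuativeCriterion (terminal.from (grassmannianScheme M k)) :=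
  ValuativeCriterion.iff.mpr ⟨valuativeCriterion_existence M k, valuativeCriterion_uniqueness M k⟩

/-- **The Grassmannian scheme is separated** as soon as it is quasi-separated over `ℤ` (Mathlib's valuative criterion for
separatedness, [StacksProject, Tag 01L0]; the quasi-separatedness is supplied by the finite affine chart cover,
[GortzWedhorn2020, Cor. 8.15]).  Cf. [GortzWedhorn2020, (9.4) p. 235] (separatedness of Grassmannians via Plücker).
[cite: GortzWedhorn2020, Example 15.12 (Section (15.2), pp. 494–497)] [cite: StacksProject, Tag 01L0] -/
theorem isSeparated_of_quasiSeparated [QuasiSeparated (terminal.from (grassmannianScheme M k))] :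
    (grassmannianScheme M k).IsSeparated :=
  ⟨IsSeparated.of_valuativeCriterion _ (valuativeCriterion_uniqueness M k)⟩

/-- **The Grassmannian scheme is universally closed over `ℤ`** as soon as it is quasi-compact (`M` finitely generated;
Mathlib's valuative criterion for universal closedness, [StacksProject, Tag 01KF]).
[cite: GortzWedhorn2020, Example 15.12 (Section (15.2), pp. 494–497)] [cite: StacksProject, Tag 01KF] -/
theorem universallyClosed_of_quasiCompact [Module.Finite ℤ M]
    [QuasiCompact (terminal.from (grassmannianScheme M k))] :
    UniversallyClosed (terminal.from (grassmannianScheme M k)) :=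
  UniversallyClosed.of_valuativeCriterion _ (valuativeCriterion_existence M k)

/-- **The Grassmannian scheme is proper over `ℤ`** ([GortzWedhorn2020, Thm. 13.40 / Example 15.12]) as soon as it is
quasi-compact, quasi-separated and locally of finite type over `ℤ` — the three side conditions of Mathlib's valuative
criterion for properness ([StacksProject, Tag 0BX5]), all supplied by the finite open cover by affine spaces `𝔸^{k(n−k)}_ℤ`
([GortzWedhorn2020, Cor. 8.15]). [cite: GortzWedhorn2020, Example 15.12 (Section (15.2), pp. 494–497)] [cite: StacksProject, Tag 0BX5] -/
theorem isProper_of_quasiCompact [Module.Finite ℤ M]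
    [QuasiCompact (terminal.from (grassmannianScheme M k))] [QuasiSeparated (terminal.from (grassmannianScheme M k))]
    [LocallyOfFiniteType (terminal.from (grassmannianScheme M k))] :
    IsProper (terminal.from (grassmannianScheme M k)) :=
  IsProper.of_valuativeCriterion _ (valuativeCriterion M k)

end Scheme

end Literature.AlgebraicGeometry.Motives.Grassmannian
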